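import Literature.Computability.Cryptography.CsidhActionCompProofs
import Literature.NumberTheory.EllipticCurves.IsogenyHomNsmulProofs
import HarnessLib

/-!
# The CSIDH class-group action: horizontal steps (towards clause (3), transitivity)

Sibling *proofs* file (theorems only, D-0014/D-0026) of
`Literature.Computability.Cryptography.CsidhAction`, preparing the transitivity half of clause (3)
of the named fact `csidh_classGroupAction` (Castryck–Lange–Martindale–Panny–Renes, *CSIDH*,
ASIACRYPT 2018, §3 Thm. 7: "`cl(𝒪)` acts … transitively"; Waterhouse 1969, Thm. 4.5). Given an
`𝔽_p`-isogeny `ψ : E_{A₀} → E_{A₁}` between valid Montgomery curves, the label `f` with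
`act p f A₀ = A₁` is produced (in the sibling `CsidhActionTransitiveProofs`) by peeling `ker ψ`
one `π`-stable layer at a time; this file proves the individual steps:

* `exists_label_of_isPosPrim` — if `E_{A'} ` (valid) is reached from `E_A` by an `𝔽_p`-isogeny
  with kernel `E_A[𝔞_{f₁}]` for *any* primitive positive-definite form `f₁` of discriminant
  `-4p` (not necessarily reduced), then `A' = act p f A` for the label `f` of the class `[𝔞_{f₁}]`
  (the argument of clause (2): `(x)𝔞_f = (y)𝔞_{f₁}`, equal kernels, Lemma 6, Prop. 8);
* `exists_label_of_ker_eq_bot` — an `𝔽_p`-isogeny with trivial kernel forces `A₁ = A₀`;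
* `natCard_ker_eq_mul_of_factor`, `natCard_ker_comp_of_deg_eq_one` — kernel sizes along a
  factorisation `ψ = λ ∘ g` and along a degree-one isogeny;
* `exists_factor_nsmul` — if `E[ℓ] ⊆ ker ψ` then `ψ = λ ∘ [ℓ]` with `#ker λ · ℓ² = #ker ψ`;
* `exists_factor_odd` — if `E_{A₀}[𝔞_{f₁}] ⊆ ker ψ` with `f₁.a` odd then `ψ` factors through the
  valid curve `E_{act f A₀}`, `f` a label, with the complementary kernel size;
* `isPosPrim_of_prime`, `isPosPrim_four'` — the forms `(ℓ, 2c, (c² + p)/ℓ)` and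
  `((p + 1)/4, -2u, 4)`;
* `exists_label_of_ker_eq_idealKernel_four` — a kernel `E_{A₀}[(4, u + π)]`-step (`u = ±1`), via the
  odd form `((p+1)/4, -2u, 4)` and the kernel identity `c𝔞_f = τ𝔞_{f'}`
  (`comp_zsmul_mem_iff_comp_tau_mem`).

## References

* [CastryckEtAl2018] W. Castryck, T. Lange, C. Martindale, L. Panny, J. Renes, *CSIDH*,
  ASIACRYPT 2018, §3 Lemma 6, Thm. 7, §5 Prop. 8.
* [Waterhouse1969] W. C. Waterhouse, *Abelian varieties over finite fields*, Ann. Sci. ÉNS (4) 2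
  (1969), Thm. 4.5.
* [Cox2013] D. A. Cox, *Primes of the form x² + ny²*, 2nd ed., Thm. 7.7.

## Design

`noncomputable section`, `open scoped Classical`; theorems only, no definitions, no new named
facts; `IsDomain (ℤ√(-p))` as a local instance (`isDomain_zsqrtd_neg`).
-/

noncomputable section

open scoped Classical nonZeroDivisors

namespace Literature.Computability.Cryptography.Csidh

open Literature.NumberTheory.QuadraticFields.Quadratic
open Literature.NumberTheory.QuadraticFields.Quadratic.BinQF
open WeierstrassCurve

attribute [local instance] isDomain_zsqrtd_neg

variable {p : ℕ} [Fact p.Prime]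

/-! ### Kernel sizes along factorisations -/

/-- Along `ψ = λ ∘ g` (pointwise on `K̄`-points), `#ker ψ = #ker λ · #ker g`: `g` maps `ker ψ`
onto `ker λ` (isogenies are surjective on geometric points) with kernel `ker g ⊆ ker ψ`.
[folklore] -/
theorem natCard_ker_eq_mul_of_factor {W W' W'' : WeierstrassCurve (ZMod p)} [W.IsElliptic]
    [W'.IsElliptic] [W''.IsElliptic] (g : W.Isogeny W') (ψ : W.Isogeny W'') (lam : W'.Isogeny W'')
    (h : ∀ P, ψ P = lam (g P)) :
    Nat.card ψ.toAddMonoidHom.ker =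
      Nat.card lam.toAddMonoidHom.ker * Nat.card g.toAddMonoidHom.ker := by
  set ρ : ψ.toAddMonoidHom.ker →+ W'.geomPoints :=
    g.toAddMonoidHom.comp ψ.toAddMonoidHom.ker.subtype with hρ
  have hle : g.toAddMonoidHom.ker ≤ ψ.toAddMonoidHom.ker := fun P hP ↦ by
    rw [AddMonoidHom.mem_ker, Isogeny.coe_toAddMonoidHom] at hP ⊢
    rw [h, hP, map_zero]
  have hrange : ρ.range = lam.toAddMonoidHom.ker := by
    ext Q
    constructor
    · rintro ⟨T, rfl⟩
      rw [AddMonoidHom.mem_ker, Isogeny.coe_toAddMonoidHom, hρ, AddMonoidHom.comp_apply,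
        AddSubgroup.coe_subtype, Isogeny.coe_toAddMonoidHom, ← h]
      have := T.2
      rwa [AddMonoidHom.mem_ker] at this
    · intro hQ
      obtain ⟨T, rfl⟩ := g.surjective Q
      rw [AddMonoidHom.mem_ker, Isogeny.coe_toAddMonoidHom, ← h] at hQ
      exact ⟨⟨T, by rwa [AddMonoidHom.mem_ker]⟩, rfl⟩
  have hker : ρ.ker = g.toAddMonoidHom.ker.addSubgroupOf ψ.toAddMonoidHom.ker := by
    rw [hρ, ← AddMonoidHom.comap_ker]
    rfl
  rw [AddSubgroup.card_eq_card_quotient_mul_card_addSubgroup ρ.ker,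
    Nat.card_congr (QuotientAddGroup.quotientKerEquivRange ρ).toEquiv, hrange, hker,
    Nat.card_congr (AddSubgroup.addSubgroupOfEquivOfLe hle).toEquiv]

/-- Pre-composing with a degree-one isogeny does not change the kernel size. [folklore] -/
theorem natCard_ker_comp_of_deg_eq_one {W₁ W₂ W₃ : WeierstrassCurve (ZMod p)} [W₁.IsElliptic]
    [W₂.IsElliptic] [W₃.IsElliptic] (mu : W₁.Isogeny W₂) (hmu : mu.deg = 1)
    (lam : W₂.Isogeny W₃) :
    Nat.card (lam.comp mu).toAddMonoidHom.ker = Nat.card lam.toAddMonoidHom.ker := by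
  haveI : PerfectField (ZMod p) := PerfectField.ofFinite
  refine Nat.card_congr (Equiv.ofBijective
    (fun T ↦ (⟨mu T.1, by
      have := T.2
      rw [AddMonoidHom.mem_ker, Isogeny.coe_toAddMonoidHom, Isogeny.comp_apply] at this
      rwa [AddMonoidHom.mem_ker, Isogeny.coe_toAddMonoidHom]⟩ : lam.toAddMonoidHom.ker))
    ⟨fun T₁ T₂ h12 ↦ ?_, fun S ↦ ?_⟩)
  · simp only [Subtype.mk.injEq] at h12
    exact Subtype.ext (sub_eq_zero.1 (eq_zero_of_deg_eq_one mu hmu (by rw [map_sub, h12, sub_self])))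
  · obtain ⟨T, hT⟩ := mu.surjective S.1
    refine ⟨⟨T, ?_⟩, Subtype.ext (by simpa using hT)⟩
    have := S.2
    rw [AddMonoidHom.mem_ker, Isogeny.coe_toAddMonoidHom] at this
    rw [AddMonoidHom.mem_ker, Isogeny.coe_toAddMonoidHom, Isogeny.comp_apply, hT, this]

/-- **Stripping `E[ℓ]`**: if `E_{A₀}[ℓ] ⊆ ker ψ` for a prime `ℓ ≠ p`, then `ψ = λ ∘ [ℓ]`
(*AEC* Cor. III.4.11) with `#ker λ · ℓ² = #ker ψ`. [cite: SilvermanAEC2009, Cor. III.4.11 and Cor. III.6.4] -/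
theorem exists_factor_nsmul (hp8 : p % 8 = 3) {A₀ A₁ : ZMod p} (hA₀ : IsCoeff p A₀)
    (hA₁ : IsCoeff p A₁) (ψ : (curve p A₀).Isogeny (curve p A₁)) {ℓ : ℕ} (hℓ : ℓ.Prime)
    (hℓp : ℓ ≠ p) (hle : geomTorsion (curve p A₀) ℓ ≤ ψ.toAddMonoidHom.ker) :
    ∃ lam : (curve p A₀).Isogeny (curve p A₁),
      Nat.card lam.toAddMonoidHom.ker * ℓ ^ 2 = Nat.card ψ.toAddMonoidHom.ker := by
  haveI := isElliptic_of_isCoeff hp8 hA₀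
  haveI := isElliptic_of_isCoeff hp8 hA₁
  haveI : NeZero p := ⟨(Fact.out : p.Prime).ne_zero⟩
  have hℓK : ((ℓ : ℕ) : ZMod p) ≠ 0 := fun h0 ↦
    hℓp ((Nat.prime_dvd_prime_iff_eq Fact.out hℓ).1 ((ZMod.natCast_eq_zero_iff ℓ p).1 h0)).symm
  obtain ⟨lam, hlam⟩ := Isogeny.exists_eq_comp_nsmul_of_geomTorsion_le_ker_holds
    (W := curve p A₀) (W' := curve p A₁) hℓK ψ (fun P hP ↦ by
      have := hle hP
      rwa [AddMonoidHom.mem_ker] at this)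
  have hℓ0 : (ℓ : ℤ) ≠ 0 := by exact_mod_cast hℓ.ne_zero
  set g := Isogeny.zsmul (curve p A₀) ℓ hℓ0 with hg
  have hfac : ∀ P, ψ P = lam (g P) := fun P ↦ by
    rw [hlam P, hg, Isogeny.zsmul_apply, natCast_zsmul]
  refine ⟨lam, ?_⟩
  rw [natCard_ker_eq_mul_of_factor g ψ lam hfac]
  congr 1
  -- `#E[ℓ] = ℓ²`
  have hker : g.toAddMonoidHom.ker = geomTorsion (curve p A₀) ℓ := by
    ext T
    rw [AddMonoidHom.mem_ker, Isogeny.coe_toAddMonoidHom, hg, Isogeny.zsmul_apply]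
    exact (Submodule.mem_torsionBy_iff _ _).symm
  rw [hker]
  have hℓK' : (ℓ : AlgebraicClosure (ZMod p)) ≠ 0 := by
    rw [← map_natCast (algebraMap (ZMod p) (AlgebraicClosure (ZMod p))), map_ne_zero]
    exact hℓK
  exact (card_torsionBy_eq_sq (E := (curve p A₀).baseChange (AlgebraicClosure (ZMod p))) hℓK').symm

/-! ### From a horizontal kernel to a label -/

/-- Two primitive positive-definite forms of discriminant `-4p` with the same ideal class have
`(x)𝔞_f = (y)𝔞_g` for non-zero `x, y ∈ ℤ[√-p]` (Cox Thm. 7.7 via `cox_formClassGroup_holds`,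
and Mathlib's `ClassGroup.mk_eq_mk_of_coe_ideal`). [cite: Cox2013, §7.B Thm. 7.7] -/
theorem exists_span_mul_ideal_eq_of_toClass_eq (hp5 : 5 ≤ p) {f g : BinQF}
    (hf : f.IsPosPrim (4 * -(p : ℤ))) (hg : g.IsPosPrim (4 * -(p : ℤ)))
    (h : toClass (-(p : ℤ)) f = toClass (-(p : ℤ)) g) :
    ∃ x y : ℤ√(-(p : ℤ)), x ≠ 0 ∧ y ≠ 0 ∧
      Ideal.span {x} * ideal (-(p : ℤ)) f = Ideal.span {y} * ideal (-(p : ℤ)) g := by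
  have hd : (-(p : ℤ)) < 0 := by have := hp5; omega
  have cox := cox_formClassGroup_holds
  have huf : IsUnit (fracIdeal (-(p : ℤ)) f) := (cox _ hd).1 f hf
  have hug : IsUnit (fracIdeal (-(p : ℤ)) g) := (cox _ hd).1 g hg
  rw [toClass_of_isUnit huf, toClass_of_isUnit hug] at h
  exact (ClassGroup.mk_eq_mk_of_coe_ideal (by exact huf.unit_spec) (by exact hug.unit_spec)).mp h

/-- **A horizontal step is an `act`.** Let `f₁` be any primitive positive-definite form of
discriminant `-4p`, `A, A'` valid, and `φ : E_A → E_{A'}` an `𝔽_p`-isogeny with kernel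
`E_A[𝔞_{f₁}]`. Then `A' = act p f A` for the label `f` of the class `[𝔞_{f₁}]`: with
`(x)𝔞_f = (y)𝔞_{f₁}`, the `𝔽_p`-isogenies `g_f ∘ x : E_A → E_{act f A}` and `φ ∘ y : E_A → E_{A'}`
have the same kernel, so their codomains are `𝔽_p`-isomorphic (Lemma 6) and the valid
coefficients agree (Prop. 8). [cite: CastryckEtAl2018, §3 Lemma 6 and Thm. 7, §5 Prop. 8] -/
theorem exists_label_of_isPosPrim (hp8 : p % 8 = 3) (hp5 : 5 ≤ p) {A A' : ZMod p}
    (hA : IsCoeff p A) (hA' : IsCoeff p A') {f₁ : BinQF} (hf₁ : f₁.IsPosPrim (4 * -(p : ℤ)))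
    (φ : (curve p A).Isogeny (curve p A')) (hφ : φ.toAddMonoidHom.ker = idealKernel p f₁ A) :
    ∃ f : BinQF, IsLabel (-(p : ℤ)) f ∧ act p f A = A' := by
  have hd : (-(p : ℤ)) < 0 := by have := hp5; omega
  have cox := cox_formClassGroup_holds
  haveI : PerfectField (ZMod p) := PerfectField.ofFinite
  set f := ofClass (-(p : ℤ)) (toClass (-(p : ℤ)) f₁) with hfdef
  have hf : IsLabel (-(p : ℤ)) f := isLabel_ofClass cox hd _
  have htc : toClass (-(p : ℤ)) f = toClass (-(p : ℤ)) f₁ := toClass_ofClass cox hd _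
  refine ⟨f, hf, ?_⟩
  set A₂ := act p f A with hA₂
  have vA₂ : IsCoeff p A₂ := isCoeff_act' hp8 hf hA
  haveI := isElliptic_of_isCoeff hp8 hA
  haveI := isElliptic_of_isCoeff hp8 hA'
  haveI := isElliptic_of_isCoeff hp8 vA₂
  obtain ⟨gf, hgf⟩ := exists_isogeny_act' hp8 hf hA
  rw [idealKernel_eq_idealTorsion hp8 hA f] at hgf
  have hφ' := hφ
  rw [idealKernel_eq_idealTorsion hp8 hA f₁] at hφ'
  -- the ideal relation and the endomorphisms `x`, `y`
  obtain ⟨x, y, hx, hy, hrel⟩ := exists_span_mul_ideal_eq_of_toClass_eq hp5 hf.1 hf₁ htc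
  obtain ⟨φx, hφx⟩ := exists_isogeny_re_im hp8 hA (re_ne_zero_or_im_ne_zero hx)
  obtain ⟨φy, hφy⟩ := exists_isogeny_re_im hp8 hA (re_ne_zero_or_im_ne_zero hy)
  have hφx' : ∀ T, φx T = zact p A x T := fun T ↦ by rw [hφx, zact_apply]
  have hφy' : ∀ T, φy T = zact p A y T := fun T ↦ by rw [hφy, zact_apply]
  set ψL := gf.comp φx with hψL
  set ψR := φ.comp φy with hψR
  have hkL : ψL.toAddMonoidHom.ker = idealTorsion p A (Ideal.span {x} * ideal (-(p : ℤ)) f) := by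
    rw [idealTorsion_span_singleton_mul hp8 hA]
    ext T
    rw [AddMonoidHom.mem_ker, AddSubgroup.mem_comap, Isogeny.coe_toAddMonoidHom, hψL,
      Isogeny.comp_apply, hφx', ← hgf, AddMonoidHom.mem_ker, Isogeny.coe_toAddMonoidHom]
  have hkR : ψR.toAddMonoidHom.ker = idealTorsion p A (Ideal.span {y} * ideal (-(p : ℤ)) f₁) := by
    rw [idealTorsion_span_singleton_mul hp8 hA]
    ext T
    rw [AddMonoidHom.mem_ker, AddSubgroup.mem_comap, Isogeny.coe_toAddMonoidHom, hψR,
      Isogeny.comp_apply, hφy', ← hφ', AddMonoidHom.mem_ker, Isogeny.coe_toAddMonoidHom]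
  have hK : ψL.toAddMonoidHom.ker = ψR.toAddMonoidHom.ker := by rw [hkL, hkR, hrel]
  -- Lemma 6 through the separable quotient by the common kernel
  obtain ⟨W₀, hW₀, g₀, hg₀ker, hg₀deg⟩ := exists_separable_isogeny_ker_eq_holds (curve p A)
    ψL.toAddMonoidHom.ker ψL.finite_ker (fun σ P hP ↦ by
      rw [AddMonoidHom.mem_ker, Isogeny.coe_toAddMonoidHom] at hP ⊢
      rw [Isogeny.map_smul, hP, smul_zero])
  haveI := hW₀
  have hg₀deg' : g₀.deg = Nat.card g₀.toAddMonoidHom.ker := by rw [hg₀ker, hg₀deg]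
  obtain ⟨mu, hmu⟩ := exists_isogeny_deg_eq_one_of_ker_eq_ker g₀ hg₀deg' ψL ψR hg₀ker.symm
    (hK.symm.trans hg₀ker.symm)
  obtain ⟨C, hC⟩ := exists_variableChange_of_deg_eq_one mu hmu
  exact (eq_of_variableChange_of_isCoeff hp8 hA' C hC).symm

/-- **Trivial kernel.** An `𝔽_p`-isogeny `E_{A₀} → E_{A₁}` with trivial kernel between valid curves
forces `A₁ = A₀` (it is a power of Frobenius followed by an `𝔽_p`-isomorphism, and `E^{(p)} = E`
over `𝔽_p`), so the principal label joins them. [cite: CastryckEtAl2018, §3 Lemma 6, §5 Prop. 8] -/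
theorem exists_label_of_ker_eq_bot (hp8 : p % 8 = 3) (hp5 : 5 ≤ p) {A₀ A₁ : ZMod p}
    (hA₀ : IsCoeff p A₀) (hA₁ : IsCoeff p A₁) (ψ : (curve p A₀).Isogeny (curve p A₁))
    (hker : ψ.toAddMonoidHom.ker = ⊥) :
    ∃ f : BinQF, IsLabel (-(p : ℤ)) f ∧ act p f A₀ = A₁ := by
  haveI := isElliptic_of_isCoeff hp8 hA₀
  haveI := isElliptic_of_isCoeff hp8 hA₁
  haveI : PerfectField (ZMod p) := PerfectField.ofFinite
  obtain ⟨mu, hmu⟩ := exists_isogeny_deg_eq_one_of_ker_eq_bot ψ hker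
  obtain ⟨C, hC⟩ := exists_variableChange_of_deg_eq_one mu hmu
  have h10 : A₁ = A₀ := eq_of_variableChange_of_isCoeff hp8 hA₁ C hC
  refine ⟨principalForm (-(p : ℤ)), isLabel_principalForm _ (by have := hp5; omega), ?_⟩
  rw [act_principalForm' hp8 hp5 hA₀, h10]

/-! ### Odd steps -/

/-- **Factoring through an odd horizontal step.** If `E_{A₀}[𝔞_{f₁}] ⊆ ker ψ` for a form `f₁`
with `a` odd (primitive, positive definite, discriminant `-4p`), then `ψ : E_{A₀} → E_{A₁}` factors
through the valid curve `E_{A'}`, `A' = act p f A₀` for a label `f`, by an `𝔽_p`-isogeny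
`λ' : E_{A'} → E_{A₁}` with `#ker λ' · #E_{A₀}[𝔞_{f₁}] = #ker ψ`. [cite: CastryckEtAl2018, §3 Lemma 6 and Thm. 7] -/
theorem exists_factor_odd (hp8 : p % 8 = 3) (hp5 : 5 ≤ p) {A₀ A₁ : ZMod p}
    (hA₀ : IsCoeff p A₀) (hA₁ : IsCoeff p A₁) (ψ : (curve p A₀).Isogeny (curve p A₁))
    {f₁ : BinQF} (hf₁ : f₁.IsPosPrim (4 * -(p : ℤ))) (hodd : Odd f₁.a)
    (hle : idealKernel p f₁ A₀ ≤ ψ.toAddMonoidHom.ker) :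
    ∃ (A' : ZMod p) (f : BinQF) (lam : (curve p A').Isogeny (curve p A₁)),
      IsCoeff p A' ∧ IsLabel (-(p : ℤ)) f ∧ act p f A₀ = A' ∧
      Nat.card lam.toAddMonoidHom.ker * Nat.card (idealKernel p f₁ A₀) =
        Nat.card ψ.toAddMonoidHom.ker := by
  haveI := isElliptic_of_isCoeff hp8 hA₀
  haveI := isElliptic_of_isCoeff hp8 hA₁
  haveI : PerfectField (ZMod p) := PerfectField.ofFinite
  have hf₁a : f₁.a ≠ 0 := hf₁.a_pos.ne'
  -- the separable quotient by `E[𝔞_{f₁}]` and the odd act-result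
  obtain ⟨W', hW', g, hgker, hgdeg⟩ := exists_quotient_idealKernel' hp8 hf₁a hA₀
  haveI := hW'
  obtain ⟨A', hA', φ₁, hφ₁⟩ := exists_isActResult_of_odd hp8 hodd hA₀
  haveI := isElliptic_of_isCoeff hp8 hA'
  obtain ⟨f, hf, hact⟩ := exists_label_of_isPosPrim hp8 hp5 hA₀ hA' hf₁ φ₁ hφ₁
  have hgdeg' : g.deg = Nat.card g.toAddMonoidHom.ker := by rw [hgker, hgdeg]
  -- `E_{A'} ≅ W'` over `𝔽_p`, and `ψ = λ ∘ g`
  obtain ⟨mu, hmu⟩ := exists_isogeny_deg_eq_one_of_ker_eq_ker g hgdeg' φ₁ g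
    (hφ₁.trans hgker.symm) rfl
  obtain ⟨lam, hlam⟩ := g.exists_eq_comp_of_ker_le ψ hgdeg'.le (fun P hP ↦ by
    have hP' : P ∈ ψ.toAddMonoidHom.ker := hle (by rw [← hgker, AddMonoidHom.mem_ker]; exact hP)
    rwa [AddMonoidHom.mem_ker] at hP')
  refine ⟨A', f, lam.comp mu, hA', hf, hact, ?_⟩
  rw [natCard_ker_comp_of_deg_eq_one mu hmu lam, natCard_ker_eq_mul_of_factor g ψ lam hlam, hgker]

omit [Fact p.Prime] in
/-- The form `(ℓ, 2c, (c² + p)/ℓ)` for an odd prime `ℓ ∤ c` with `ℓ ∣ c² + p` is primitive positive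
definite of discriminant `-4p` (its ideal is `(ℓ, -c + √-p)`). [cite: Cox2013, §7.B Thm. 7.7(i)] -/
theorem isPosPrim_of_prime {ℓ : ℕ} (hℓ : ℓ.Prime) (hℓ2 : ℓ ≠ 2) (c : ℤ)
    (hdiv : (ℓ : ℤ) ∣ c ^ 2 + p) (hndiv : ¬ (ℓ : ℤ) ∣ c) :
    (⟨ℓ, 2 * c, (c ^ 2 + p) / ℓ⟩ : BinQF).IsPosPrim (4 * -(p : ℤ)) := by
  obtain ⟨q, hq⟩ := hdiv
  have hℓ0 : (ℓ : ℤ) ≠ 0 := by exact_mod_cast hℓ.ne_zero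
  have hq' : (c ^ 2 + p) / ℓ = q := by rw [hq, Int.mul_ediv_cancel_left _ hℓ0]
  refine ⟨?_, by show (0 : ℤ) < (ℓ : ℤ); exact_mod_cast hℓ.pos, ?_⟩
  · rw [disc]
    simp only [hq']
    linear_combination (4 : ℤ) * hq
  · -- primitive: `gcd(ℓ, 2c) = 1`
    have h1 : Nat.gcd ℓ (2 * c).natAbs = 1 := by
      apply Nat.Coprime.gcd_eq_one
      rw [hℓ.coprime_iff_not_dvd, Int.natAbs_mul]
      intro h
      apply hndiv
      have h2 : ℓ ∣ c.natAbs :=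
        ((Nat.coprime_primes hℓ Nat.prime_two).2 hℓ2).dvd_of_dvd_mul_left (by simpa using h)
      exact Int.natCast_dvd.2 h2
    show Nat.gcd (Nat.gcd (ℓ : ℤ).natAbs (2 * c).natAbs) ((c ^ 2 + p) / ℓ).natAbs = 1
    rw [Int.natAbs_natCast, h1, Nat.gcd_one_left]

/-! ### The `4`-step for `p ≡ 3 (mod 8)` -/

omit [Fact p.Prime] in
/-- The form `((p + 1)/4, -2u, 4)` (`u = ±1`, `p ≡ 3 (mod 8)`) is primitive positive definite of
discriminant `-4p`, with odd leading coefficient. [cite: Cox2013, §2.A] -/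
theorem isPosPrim_four' (hp8 : p % 8 = 3) {u : ℤ} (hu : u = 1 ∨ u = -1) :
    (⟨((p : ℤ) + 1) / 4, -(2 * u), 4⟩ : BinQF).IsPosPrim (4 * -(p : ℤ)) := by
  have hk4 : 4 * (((p : ℤ) + 1) / 4) = p + 1 := by omega
  have hu2 : u ^ 2 = 1 := by rcases hu with rfl | rfl <;> norm_num
  refine ⟨?_, by show (0 : ℤ) < ((p : ℤ) + 1) / 4; omega, ?_⟩
  · rw [disc]
    show (-(2 * u)) ^ 2 - 4 * (((p : ℤ) + 1) / 4) * 4 = 4 * -(p : ℤ)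
    linear_combination 4 * hu2 - 4 * hk4
  · have hodd : (((p : ℤ) + 1) / 4).natAbs % 2 = 1 := by omega
    have h2u : (-(2 * u)).natAbs = 2 := by rcases hu with rfl | rfl <;> norm_num
    have h1 : Nat.gcd (((p : ℤ) + 1) / 4).natAbs 2 = 1 := by
      have hdvd : Nat.gcd (((p : ℤ) + 1) / 4).natAbs 2 ∣ 2 := Nat.gcd_dvd_right _ _
      rcases (Nat.dvd_prime Nat.prime_two).1 hdvd with h | h
      · exact h
      · exfalso
        have : 2 ∣ (((p : ℤ) + 1) / 4).natAbs := h ▸ Nat.gcd_dvd_left _ _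
        omega
    show Nat.gcd (Nat.gcd (((p : ℤ) + 1) / 4).natAbs (-(2 * u)).natAbs) (4 : ℤ).natAbs = 1
    rw [h2u, h1, Nat.gcd_one_left]

/-- **A `(4, u + π)`-step is an `act`** (`p ≡ 3 (mod 8)`, `u = ±1`): if `ψ : E_{A₀} → E_{A₁}`
has kernel `E_{A₀}[𝔞_{f₄}]`, `f₄ = (4, 2u, (p+1)/4)`, then `A₁ = act p f A₀` for a label `f`. With
the odd form `f₄' = ((p+1)/4, -2u, 4)` and `τ = -u + π`, the `𝔽_p`-isogenies `ψ ∘ [(p+1)/4]` and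
`g' ∘ τ` (`g'` the odd step for `f₄'`) have the same kernel (`c 𝔞_{f₄} = τ 𝔞_{f₄'}`,
`comp_zsmul_mem_iff_comp_tau_mem`), so `E_{A₁}` is the codomain of the odd step (Lemma 6,
Prop. 8), to which `exists_label_of_isPosPrim` applies.
[cite: CastryckEtAl2018, §3 Lemma 6 and Thm. 7, §5 Prop. 8] -/
theorem exists_label_of_ker_eq_idealKernel_four (hp8 : p % 8 = 3) (hp5 : 5 ≤ p) {A₀ A₁ : ZMod p}
    (hA₀ : IsCoeff p A₀) (hA₁ : IsCoeff p A₁) (ψ : (curve p A₀).Isogeny (curve p A₁)) {u : ℤ}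
    (hu : u = 1 ∨ u = -1)
    (hker : ψ.toAddMonoidHom.ker = idealKernel p ⟨4, 2 * u, ((p : ℤ) + 1) / 4⟩ A₀) :
    ∃ f : BinQF, IsLabel (-(p : ℤ)) f ∧ act p f A₀ = A₁ := by
  haveI := isElliptic_of_isCoeff hp8 hA₀
  haveI := isElliptic_of_isCoeff hp8 hA₁
  haveI : PerfectField (ZMod p) := PerfectField.ofFinite
  set k : ℤ := ((p : ℤ) + 1) / 4 with hk
  have hk4 : 4 * k = p + 1 := by omega
  have hkodd : Odd k := ⟨k / 2, by omega⟩
  have hu0 : u ≠ 0 := by rcases hu with rfl | rfl <;> norm_num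
  have hu2 : u ^ 2 = 1 := by rcases hu with rfl | rfl <;> norm_num
  set f₄ : BinQF := ⟨4, 2 * u, k⟩ with hf₄
  set f₄' : BinQF := ⟨k, -(2 * u), 4⟩ with hf₄'
  have hb' : f₄.b / 2 = u := Int.mul_ediv_cancel_left _ two_ne_zero
  have hb2 : f₄.b = 2 * (f₄.b / 2) := by rw [hb']
  have hkey : (f₄.b / 2) ^ 2 + p = f₄.a * f₄.c := by
    rw [hb', hu2]
    show (1 : ℤ) + p = 4 * k
    omega
  -- the odd step for `f₄'` and the endomorphism `τ = -u + π`
  have hodd : Odd f₄'.a := hkodd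
  obtain ⟨A'', hA'', g', hg'⟩ := exists_isActResult_of_odd hp8 hodd hA₀
  haveI := isElliptic_of_isCoeff hp8 hA''
  obtain ⟨τ, hτ⟩ := exists_isogeny_zsmul_add_frob hp8 hA₀ (m := -u) (neg_ne_zero.2 hu0)
  have hk0 : k ≠ 0 := by omega
  set ψ₁ := ψ.comp (Isogeny.zsmul (curve p A₀) k hk0) with hψ₁
  set ψ₂ := g'.comp τ with hψ₂
  have hK : ψ₁.toAddMonoidHom.ker = ψ₂.toAddMonoidHom.ker := by
    ext T
    rw [AddMonoidHom.mem_ker, AddMonoidHom.mem_ker, Isogeny.coe_toAddMonoidHom,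
      Isogeny.coe_toAddMonoidHom, hψ₁, hψ₂, Isogeny.comp_apply, Isogeny.comp_apply,
      Isogeny.zsmul_apply, hτ]
    have h1 : ψ (k • T) = 0 ↔ f₄.c • T ∈ idealKernel p f₄ A₀ := by
      rw [← hker, AddMonoidHom.mem_ker, Isogeny.coe_toAddMonoidHom]
    have h2 : g' (-u • T + frob p • T) = 0 ↔
        (-(f₄.b / 2)) • T + frob p • T ∈ idealKernel p (⟨f₄.c, -f₄.b, f₄.a⟩ : BinQF) A₀ := by
      rw [hb', ← hg', AddMonoidHom.mem_ker, Isogeny.coe_toAddMonoidHom]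
    rw [h1, h2]
    exact comp_zsmul_mem_iff_comp_tau_mem hp8 hA₀ hb2 hkey T
  -- Lemma 6: `E_{A₁} ≅ E_{A''}` over `𝔽_p`
  obtain ⟨W₀, hW₀, g₀, hg₀ker, hg₀deg⟩ := exists_separable_isogeny_ker_eq_holds (curve p A₀)
    ψ₁.toAddMonoidHom.ker ψ₁.finite_ker (fun σ P hP ↦ by
      rw [AddMonoidHom.mem_ker, Isogeny.coe_toAddMonoidHom] at hP ⊢
      rw [Isogeny.map_smul, hP, smul_zero])
  haveI := hW₀
  have hg₀deg' : g₀.deg = Nat.card g₀.toAddMonoidHom.ker := by rw [hg₀ker, hg₀deg]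
  obtain ⟨mu, hmu⟩ := exists_isogeny_deg_eq_one_of_ker_eq_ker g₀ hg₀deg' ψ₁ ψ₂ hg₀ker.symm
    (hK.symm.trans hg₀ker.symm)
  obtain ⟨C, hC⟩ := exists_variableChange_of_deg_eq_one mu hmu
  have hAeq : A'' = A₁ := eq_of_variableChange_of_isCoeff hp8 hA'' C hC
  -- the odd form gives the label
  have hf₄'pp : f₄'.IsPosPrim (4 * -(p : ℤ)) := isPosPrim_four' hp8 hu
  obtain ⟨f, hf, hact⟩ := exists_label_of_isPosPrim hp8 hp5 hA₀ hA'' hf₄'pp g' hg'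
  exact ⟨f, hf, hact.trans hAeq⟩

end Literature.Computability.Cryptography.Csidh
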